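import Summits.ResolutionOfSingularities.ResolutionOfSingularities.Theorems.WeightedInvariantWeightedConstructionACEquivalence

/-!
# Line `pointwise-lexmax-hull` for crux `WeightedConstruction` (stmt-ResolutionOfSingularities-0571)

Crux-strategist skeleton (wall-breaker gen 1, planner-cstrat-stmt-ResolutionOfSingularities-0571-p1-0,
2026-08-17). Route `ResolutionOfSingularities/WeightedInvariant`; crux
`WeightedConstruction = ∀ p prime, Nonempty (WeightedResolutionDatum p)`.

THE NAMED INHABITANT (what every dead line of this crux lacked — a1 §4, a2 §5, c5 R2, PICKED a3):

* `plex y` — at a CLOSED point `y` (perfect residue field, so "pointwise" is unambiguous) the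
  Abramovich–Temkin–Włodarczyk / Abramovich–Quek–Schober MAXIMAL ADMISSIBLE PROFILE: the lexicographic
  supremum, in the `∞`-padded order on sorted sequences `(d/w₁ ≤ d/w₂ ≤ …)`, over all regular weighted
  charts `(U ∋ y, u, w, d)` with `u` part of a regular system of parameters AT `y` and `X|_U ⊆ (u^α : Σ wᵢαᵢ ≥ d)`
  (ATW 2024 §5 "the centre is the unique admissible centre of maximal invariant"; AQS arXiv:2507.01232
  Def. 3.3 / Thm. 3.5 in dimension 2 over ANY field) — `AdmissibleProfileAt`, field `plex_isGreatest`;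
* `gen η` — the GENERIC value of `plex` on the closed points of `closure {η}` (`gen_spec`);
* `hull y` — the upper-semicontinuous hull: the maximum of `gen η` over the singular generisations
  `η ⤳ y` (`hull_isGreatest`); specialisation-monotone BY CONSTRUCTION (this is the repair of the
  usc failure of the root/Diff tower at Hauser–Perlega's Example 1, TOWER-CENSUS-c5 §3);
* the CENTRE — among regular weighted centres supported EXACTLY on the maximum locus of `hull` and
  admissible for `X` (`support_centre`, `le_piece`), a chartwise lex-maximal one (`centre_max`): a
  `ReesAlgebraData` is `𝒪_Y`-coherent, hence automatically `κ(η)`-rational at the generic point of the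
  maximum locus — the Frobenius-TWISTED pointwise centres of the umbrella / of the 𝔽₂-specimen
  `z⁸ + x²y⁸(1+y)` (triage r1-1 F2/F4, support-first N1) are excluded by the SUPPORT constraint, not by
  fiat, and AQS's `K`-rational centre at generic points (GENERIC-SLICE-c5 §2) is what remains.

So: `inv := hull` (support FIRST = its maximum locus), weights SECOND = support-constrained lexmax —
the triage's demanded sharpening of `support-first-weights-second` ("support := max locus OF WHAT")
with the concrete answer "of the usc hull of the pointwise ATW/AQS profile". Hand calibration (line
card §Calibration; every standing specimen of this crux): char-2 umbrella, the 𝔽₂ specimen, the fuel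
witness `z²+y³+ty⁴+t⁶y` that killed line `weighted-oblique-fuel` ((2,3,9) → (2,3,3,12)), c5's `f_k`
family ((2,4,4) → (2,3,6k−3)), HP Example 1 (usc by construction; u-axis centre; successors
(8,10,10), (8,11,11,11), (8,12,12) < (8,16,16,16)), `x²+y²(1+y)z²+z⁵` ((2,4,4) → (2,3,3)). Two nearby
readings are REFUTED by hand there (rating at generic points `κ(η)`-rationally: increase on
`x²+y²(1+y)z²+z⁵`; rating geometrically over `κ(η)^alg`: increase (2,3,9) → (2,3,∞) on the fuel
witness through regular-non-smooth points) — which is why the rule reads `plex` at CLOSED points and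
takes generic values, and reads the CENTRE rationally.

STUBS (5, registered; sizes are guesses):
* `stub_ruleExists` [L, static char-free algebra + constructibility]: `Nonempty (LexmaxHullRule p)` —
  the admissible-profile supremum at a closed singular point is attained (ATW §5 / AQS Thm 3.5 in all
  dimensions and characteristics), `plex` is constructible on closed points (so `gen` exists), finitely
  many values (so `hull` exists), support-constrained maximisers exist where charts exist.
* `stub_hullUsc` [M/L]: `(usc)` of `hull` on the singular locus, `(i)` for smooth morphisms and
  perfect ground-field extensions (ATW functoriality of the maximal admissible centre; AQS Thm 3.5
  "stable under separable base change").
* `stub_centreRegular` [L]: `(iii)` — the maximum locus of `hull` is REGULAR and the centre is a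
  regular weighted centre, functorial for smooth surjections / perfect base change (ATW: max locus of
  `inv` is smooth; here a claim about the hull — a singular point of the closure of a stratum is
  expected to be isolated by its own profile, e.g. the node of a nodal curve of cusps: (2,6,6) > (2,3)).
* `stub_hullDrop` [XL, THE CORE, research]: `(iv)` in the landed ACChart form (over `k̄`, on weighted
  chart opens, at CLOSED SINGULAR EXCEPTIONAL points): `hull` of the cobordant successor pair is
  strictly `∞`-lex below the maximum. Falsifiable by one specimen; passes the six above by hand.
* `stub_recoding` [L/XL, the S2 content made explicit]: a rule with `(usc)`,`(i)`,`(iii)`,`(iv)` in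
  the PROFILE order yields an `ACChartPreDatum p` — i.e. a well-ordered recoding of the realised
  profile values (`∞`-lex on all profiles is NOT well-founded, cdisprove Part I §2 / a2 §4; needed:
  bounded lengthening along forced chains — components of the top locus on `B₊^{(m)}` contain the
  `𝔾ₘ^m`-orbits, so transversal dimension stays `≤ dim Y`) plus the `(ii)`-packaging `inv := ⊥` at
  regular-or-absent points (shape of `SupportFirstPreDatum.toDatum`, c1/c5).
Composition `WeightedConstruction_of`: kernel-checked, via the landed
`Theorems.weightedConstruction_iff_acChartPreDatum` (p136232).

Disproof used: `false_of_smoothLocalEquivalence` / `not_nonempty_of_*_reproduction` (Part III §C3.2) —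
the rule never reproduces a maximum point on the six specimens (values strictly drop); §C3.1 symmetry
levers are honoured automatically (plex, gen, hull, and "lex-maximal among max-locus-supported centres"
are invariant under every automorphism / smooth self-correspondence of the pair); NEGATIVE-c4's
`SurvivingFamily` is exactly what `stub_hullDrop` bets against; S2 (`not_wellFounded_atwLT`, Part I §2)
is carried by `stub_recoding`, not hidden.
-/

noncomputable section

open CategoryTheory CategoryTheory.Limits AlgebraicGeometry TopologicalSpace
open Literature.AlgebraicGeometry.Resolution
open Summit.ResolutionOfSingularities.ResolutionOfSingularities.Theses.WeightedInvariant
open Summit.ResolutionOfSingularities.ResolutionOfSingularities.Theorems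

set_option linter.dupNamespace false

namespace Summit.ResolutionOfSingularities.ResolutionOfSingularities.Cruxes.WeightedConstruction.PointwiseLexmaxHull

/-! ## Profiles: sorted weight-inverses, `∞`-padded, compared lexicographically -/

/-- **Profiles.** A profile is an eventually-`⊤` sequence of rationals read lexicographically:
`(a₁, a₂, …, a_k, ⊤, ⊤, …)`; the `⊤`-padding realises the ATW/AQS convention that a TRUNCATED sequence
is LARGER (`(2,3) = (2,3,⊤) > (2,3,5)`), which is also what makes the lexmax exclude free smooth
directions (a direction of weight `0` contributes `⊤`). NOT well-founded as a type — see
`stub_recoding`. [cite: AbramovichTemkinWlodarczyk2024, §5; arXiv:2507.01232, Def. 3.2] -/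
abbrev Profile : Type := Lex (ℕ → WithTop ℚ)

/-- The profile of a weighted chart with weights `w` (listed so that `d / wᵢ` is non-decreasing,
i.e. `w` antitone) normalised in degree `d`: `n ↦ d / wₙ` for `n < m`, `⊤` beyond. [folklore] -/
def chartProfile {m : ℕ} (d : ℕ) (w : Fin m → ℕ) : Profile :=
  toLex fun n => if h : n < m then (((d : ℚ) / (w ⟨n, h⟩ : ℚ) : ℚ) : WithTop ℚ) else ⊤

/-- `X` is SINGULAR (present and non-regular) at the point `y` of `Y`: the negation of the right-hand
side of axiom `(ii)`. [folklore] -/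
def XSing {Y : Scheme.{0}} (X : Y.IdealSheafData) (y : Y) : Prop :=
  ∃ x : X.subscheme, X.subschemeι x = y ∧ ¬ IsRegularLocalRing (X.subscheme.presheaf.stalk x)

/-- **Admissible profile at a point.** `π` is the profile of a regular weighted chart ADMISSIBLE for
`X` at `y`: an affine open `U ∋ y`, sections `u₁,…,uₘ ∈ Γ(Y,U)` vanishing at `y` whose cotangent
classes at `y` are linearly independent (part of a regular system of parameters AT `y`), positive
antitone weights `w` and a degree `d > 0` with `X|_U ⊆ (u^α : Σ wᵢαᵢ ≥ d)` — the monomial valuation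
`v(uᵢ) = wᵢ/d` has `v(X) ≥ 1` (AQS Def. 3.3 "admissible", ATW §5) — and `π = (d/w₁ ≤ … ≤ d/wₘ, ⊤, …)`.
[cite: arXiv:2507.01232, Def. 3.3; AbramovichTemkinWlodarczyk2024, §5] -/
def AdmissibleProfileAt {Y : Scheme.{0}} (X : Y.IdealSheafData) (y : Y) (π : Profile) : Prop :=
  ∃ (U : Y.affineOpens) (hy : y ∈ (U : Y.Opens)) (m : ℕ) (u : Fin m → Γ(Y, U)) (w : Fin m → ℕ) (d : ℕ),
    (∀ i, 0 < w i) ∧ Antitone w ∧ 0 < d ∧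
    (∃ h : ∀ i, (Y.presheaf.germ (U : Y.Opens) y hy).hom (u i) ∈
        IsLocalRing.maximalIdeal (Y.presheaf.stalk y),
      LinearIndependent (IsLocalRing.ResidueField (Y.presheaf.stalk y))
        (fun i => (IsLocalRing.maximalIdeal (Y.presheaf.stalk y)).toCotangent ⟨_, h i⟩)) ∧
    X.ideal U ≤ weightedMonomialIdeal u w d ∧
    π = chartProfile d w

/-- **Admissible profile at a point, with prescribed support.** As `AdmissibleProfileAt`, and the chart
is SUPPORTED EXACTLY ON the closed set `Z` over `U`: `V(u) ∩ U = Z ∩ U` (so, when `Z` is the maximum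
locus, the chart presents a centre supported exactly on it — the "support first" constraint that excludes
Frobenius-twisted point-supported centres along a stratum). [folklore] -/
def AdmissibleProfileOnAt {Y : Scheme.{0}} (X : Y.IdealSheafData) (Z : Set Y) (y : Y) (π : Profile) :
    Prop :=
  ∃ (U : Y.affineOpens) (hy : y ∈ (U : Y.Opens)) (m : ℕ) (u : Fin m → Γ(Y, U)) (w : Fin m → ℕ) (d : ℕ),
    (∀ i, 0 < w i) ∧ Antitone w ∧ 0 < d ∧
    (∃ h : ∀ i, (Y.presheaf.germ (U : Y.Opens) y hy).hom (u i) ∈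
        IsLocalRing.maximalIdeal (Y.presheaf.stalk y),
      LinearIndependent (IsLocalRing.ResidueField (Y.presheaf.stalk y))
        (fun i => (IsLocalRing.maximalIdeal (Y.presheaf.stalk y)).toCotangent ⟨_, h i⟩)) ∧
    X.ideal U ≤ weightedMonomialIdeal u w d ∧
    (∀ y' : Y, y' ∈ (U : Y.Opens) → (y' ∈ Z ↔ ∀ i, y' ∉ Y.basicOpen (u i))) ∧
    π = chartProfile d w

/-! ## The rule -/

/-- **The pointwise-lexmax-hull rule in characteristic `p`** (the line's named inhabitant, as a
structure of its OUTPUTS pinned by their defining properties; existence = `stub_ruleExists`).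
For every field `k`, `k`-scheme `f : Y → Spec k` and ideal sheaf `X` on `Y` (total data, meaningful for
`k` perfect of characteristic `p`, `f` smooth separated quasi-compact, at SINGULAR points of `X`):
`plex` = maximal admissible profile at closed points; `gen η` = generic closed-point value of `plex` on
`closure {η}`; `hull y` = maximum of `gen` over singular generisations of `y`; `centre` = a regular
weighted-chart presentation, lex-maximal among centres supported exactly on the maximum locus of `hull`
and admissible for `X` in degree `deg`. [cite: AbramovichTemkinWlodarczyk2024, §5 and Thm 1.1.1;
arXiv:2507.01232, Def. 3.3, Thm 3.5, Thm 1.1] -/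
structure LexmaxHullRule (p : ℕ) : Type 1 where
  /-- pointwise maximal admissible profile (meaningful at closed singular points) -/
  plex : ∀ ⦃k : Type⦄ [Field k] ⦃Y : Scheme.{0}⦄, (Y ⟶ Spec (.of k)) → Y.IdealSheafData → Y → Profile
  /-- generic closed-point value of `plex` on the closure of a point -/
  gen : ∀ ⦃k : Type⦄ [Field k] ⦃Y : Scheme.{0}⦄, (Y ⟶ Spec (.of k)) → Y.IdealSheafData → Y → Profile
  /-- the usc hull: max of `gen` over singular generisations (the rating `inv` on singular points) -/
  hull : ∀ ⦃k : Type⦄ [Field k] ⦃Y : Scheme.{0}⦄, (Y ⟶ Spec (.of k)) → Y.IdealSheafData → Y → Profile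
  /-- the weighted centre -/
  centre : ∀ ⦃k : Type⦄ [Field k] ⦃Y : Scheme.{0}⦄, (Y ⟶ Spec (.of k)) → Y.IdealSheafData →
    ReesAlgebraData Y
  /-- the degree in which `X` is admissible for the centre -/
  deg : ∀ ⦃k : Type⦄ [Field k] ⦃Y : Scheme.{0}⦄, (Y ⟶ Spec (.of k)) → Y.IdealSheafData → ℕ
  /-- (R2) at a CLOSED singular point, `plex` is the greatest admissible profile -/
  plex_isGreatest : ∀ ⦃k : Type⦄ [Field k] [CharP k p] [PerfectField k] ⦃Y : Scheme.{0}⦄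
    (f : Y ⟶ Spec (.of k)) [Smooth f] [IsSeparated f] [QuasiCompact f] (X : Y.IdealSheafData)
    (y : Y), IsClosed ({y} : Set Y) → XSing X y →
    IsGreatest {π | AdmissibleProfileAt X y π} (plex f X y)
  /-- (Rg) `gen η` is the value of `plex` at the closed points of a dense open part of `closure {η}` -/
  gen_spec : ∀ ⦃k : Type⦄ [Field k] [CharP k p] [PerfectField k] ⦃Y : Scheme.{0}⦄
    (f : Y ⟶ Spec (.of k)) [Smooth f] [IsSeparated f] [QuasiCompact f] (X : Y.IdealSheafData)
    (η : Y), XSing X η →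
    ∃ W : Y.Opens, η ∈ W ∧ ∀ y : Y, y ∈ W → η ⤳ y → IsClosed ({y} : Set Y) → plex f X y = gen f X η
  /-- (R1) `hull y` is the greatest `gen η` over the singular generisations `η ⤳ y` -/
  hull_isGreatest : ∀ ⦃k : Type⦄ [Field k] [CharP k p] [PerfectField k] ⦃Y : Scheme.{0}⦄
    (f : Y ⟶ Spec (.of k)) [Smooth f] [IsSeparated f] [QuasiCompact f] (X : Y.IdealSheafData)
    (y : Y), XSing X y →
    IsGreatest {π | ∃ η : Y, η ⤳ y ∧ XSing X η ∧ π = gen f X η} (hull f X y)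
  /-- (Rc1) support FIRST: the centre is supported exactly on the maximum locus of `hull` among the
  singular points (guard: some singular point) -/
  support_centre : ∀ ⦃k : Type⦄ [Field k] [CharP k p] [PerfectField k] ⦃Y : Scheme.{0}⦄
    (f : Y ⟶ Spec (.of k)) [Smooth f] [IsSeparated f] [QuasiCompact f] (X : Y.IdealSheafData),
    (∃ y : Y, XSing X y) →
    (centre f X).support = {y : Y | XSing X y ∧ ∀ y' : Y, XSing X y' → hull f X y' ≤ hull f X y}
  /-- (Rc2) the centre is admissible for `X` in degree `deg` -/
  le_piece : ∀ ⦃k : Type⦄ [Field k] [CharP k p] [PerfectField k] ⦃Y : Scheme.{0}⦄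
    (f : Y ⟶ Spec (.of k)) [Smooth f] [IsSeparated f] [QuasiCompact f] (X : Y.IdealSheafData),
    (∃ y : Y, XSing X y) → X ≤ (centre f X).piece (deg f X)
  /-- (Rc3) weights SECOND: at every point of its support the centre has a chart whose profile
  dominates every admissible profile of a chart supported exactly on the maximum locus -/
  centre_max : ∀ ⦃k : Type⦄ [Field k] [CharP k p] [PerfectField k] ⦃Y : Scheme.{0}⦄
    (f : Y ⟶ Spec (.of k)) [Smooth f] [IsSeparated f] [QuasiCompact f] (X : Y.IdealSheafData),
    (∃ y : Y, XSing X y) → ∀ (y : Y), y ∈ (centre f X).support →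
    ∀ π : Profile, AdmissibleProfileOnAt X (centre f X).support y π →
      ∃ (U : Y.affineOpens) (_ : y ∈ (U : Y.Opens)) (m : ℕ) (u : Fin m → Γ(Y, U)) (w : Fin m → ℕ),
        (centre f X).IsWeightedChart U u w ∧ Antitone w ∧ π ≤ chartProfile (deg f X) w

namespace LexmaxHullRule

variable {p : ℕ} (R : LexmaxHullRule p)

/-- `(usc)` for the rule: superlevel sets of `hull` inside the singular locus are closed. -/
def USC : Prop :=
  ∀ ⦃k : Type⦄ [Field k] [CharP k p] [PerfectField k] ⦃Y : Scheme.{0}⦄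
    (f : Y ⟶ Spec (.of k)) [Smooth f] [IsSeparated f] [QuasiCompact f] (X : Y.IdealSheafData)
    (γ : Profile), IsClosed {y : Y | XSing X y ∧ γ ≤ R.hull f X y}

/-- `(i)` for `hull`, smooth `k`-morphisms (at singular points). -/
def HullComap : Prop :=
  ∀ ⦃k : Type⦄ [Field k] [CharP k p] [PerfectField k] ⦃Y Y₁ : Scheme.{0}⦄
    (f : Y ⟶ Spec (.of k)) [Smooth f] [IsSeparated f] [QuasiCompact f]
    (f₁ : Y₁ ⟶ Spec (.of k)) [Smooth f₁] [IsSeparated f₁] [QuasiCompact f₁]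
    (g : Y₁ ⟶ Y) [Smooth g], g ≫ f = f₁ →
    ∀ (X : Y.IdealSheafData) (y₁ : Y₁), XSing X (g y₁) → R.hull f₁ (X.comap g) y₁ = R.hull f X (g y₁)

/-- `(i)` for `hull`, perfect ground-field extensions (at singular points). -/
def HullBaseChange : Prop :=
  ∀ ⦃k : Type⦄ [Field k] [CharP k p] [PerfectField k]
    ⦃K : Type⦄ [Field K] [PerfectField K] (φ : k →+* K)
    ⦃Y YK : Scheme.{0}⦄ (f : Y ⟶ Spec (.of k)) [Smooth f] [IsSeparated f] [QuasiCompact f]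
    (fK : YK ⟶ Spec (.of K)) (pr : YK ⟶ Y),
    IsPullback pr fK f (Spec.map (CommRingCat.ofHom φ)) →
    ∀ (X : Y.IdealSheafData) (y : YK), XSing X (pr y) → R.hull fK (X.comap pr) y = R.hull f X (pr y)

/-- `(iii)` for the rule: regular weighted centre, functorial for smooth surjections and perfect base
change. -/
def CentreRegular : Prop :=
  (∀ ⦃k : Type⦄ [Field k] [CharP k p] [PerfectField k] ⦃Y : Scheme.{0}⦄
    (f : Y ⟶ Spec (.of k)) [Smooth f] [IsSeparated f] [QuasiCompact f] (X : Y.IdealSheafData),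
    (∃ y : Y, XSing X y) → (R.centre f X).IsRegularWeightedCentre) ∧
  (∀ ⦃k : Type⦄ [Field k] [CharP k p] [PerfectField k] ⦃Y Y₁ : Scheme.{0}⦄
    (f : Y ⟶ Spec (.of k)) [Smooth f] [IsSeparated f] [QuasiCompact f]
    (f₁ : Y₁ ⟶ Spec (.of k)) [Smooth f₁] [IsSeparated f₁] [QuasiCompact f₁]
    (g : Y₁ ⟶ Y) [Smooth g] [Surjective g], g ≫ f = f₁ →
    ∀ (X : Y.IdealSheafData), (∃ y : Y, XSing X y) →
    ∀ n : ℕ, (R.centre f₁ (X.comap g)).piece n = ((R.centre f X).piece n).comap g) ∧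
  (∀ ⦃k : Type⦄ [Field k] [CharP k p] [PerfectField k]
    ⦃K : Type⦄ [Field K] [PerfectField K] (φ : k →+* K)
    ⦃Y YK : Scheme.{0}⦄ (f : Y ⟶ Spec (.of k)) [Smooth f] [IsSeparated f] [QuasiCompact f]
    (fK : YK ⟶ Spec (.of K)) (pr : YK ⟶ Y),
    IsPullback pr fK f (Spec.map (CommRingCat.ofHom φ)) →
    ∀ (X : Y.IdealSheafData), (∃ y : Y, XSing X y) →
    ∀ n : ℕ, (R.centre fK (X.comap pr)).piece n = ((R.centre f X).piece n).comap pr)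

/-- `(iv)` for the rule, in the landed ACChart form (Theorems/…ACReduction.lean): over an ALGEBRAICALLY
CLOSED ground field, on an affine open carrying a weighted chart of the centre, with `B₊(U) → Spec k`
smooth separated quasi-compact, at a CLOSED point `b` of the exceptional divisor at which the strict
transform is SINGULAR, the hull of the successor pair is strictly `∞`-lex below the maximum of `hull`
on the singular points of `(Y, X)`. -/
def HullDrop : Prop :=
  ∀ ⦃k : Type⦄ [Field k] [CharP k p] [PerfectField k] [IsAlgClosed k]
    ⦃Y : Scheme.{0}⦄ (f : Y ⟶ Spec (.of k)) [Smooth f] [IsSeparated f] [QuasiCompact f]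
    (X : Y.IdealSheafData), (∃ y : Y, XSing X y) →
    ∀ (U : Y.affineOpens),
      (∃ (m : ℕ) (u : Fin m → Γ(Y, U)) (w : Fin m → ℕ), (R.centre f X).IsWeightedChart U u w) →
      Smooth ((R.centre f X).cobordantPlusι U ≫ f) →
      IsSeparated ((R.centre f X).cobordantPlusι U ≫ f) →
      QuasiCompact ((R.centre f X).cobordantPlusι U ≫ f) →
      ∀ (b : (R.centre f X).cobordantPlus U), IsClosed ({b} : Set ((R.centre f X).cobordantPlus U)) →
        (affineCobordantBlowup.plusOpens ((R.centre f X).chartIdeals U)).ι b ∈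
          ((affineCobordantBlowup.exceptional ((R.centre f X).chartIdeals U)).support :
            Set (affineCobordantBlowup ((R.centre f X).chartIdeals U))) →
        XSing ((R.centre f X).cobordantStrictTransform U X) b →
        ∀ y : Y, XSing X y → (∀ y' : Y, XSing X y' → R.hull f X y' ≤ R.hull f X y) →
          R.hull ((R.centre f X).cobordantPlusι U ≫ f) ((R.centre f X).cobordantStrictTransform U X) b
            < R.hull f X y

end LexmaxHullRule

/-! ## Registered stubs -/

/-- **Stub A (static, char-free algebra + constructibility).** The rule EXISTS in every prime
characteristic: (a) at a closed singular point of a pair in the regime the admissible-profile set has a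
GREATEST element in the `∞`-padded lex order (ATW 2024 §5: the maximal admissible centre exists and is
unique, char 0; AQS arXiv:2507.01232 Thm 3.5 / arXiv:2412.16426 Thm 4.2: dimension 2, any field — the
uniqueness argument is valuative; all dimensions in char `p` to be written); (b) `plex` is constructible
on closed points, so its generic value `gen η` on `closure {η}` exists; (c) `gen` takes finitely many
values on the singular generisations of a point, so the hull maximum exists; (d) where the maximum
locus admits charts supported exactly on it, a support-constrained lex-maximal admissible centre exists
and the local maximisers glue to one `ReesAlgebraData` (uniqueness of the maximiser as a `ℚ`-ideal,
ATW/AQS). -/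
theorem stub_ruleExists : ∀ p : ℕ, p.Prime → Nonempty (LexmaxHullRule p) := by
  sorry

/-- **Stub B (`(usc)` + `(i)` for the hull).** For every rule: superlevel sets of `hull` in the singular
locus are closed (specialisation-monotone by construction of the hull; closedness from constructibility
of `gen`/`plex` and finiteness of values — the closure of a constructible set is the specialisation
closure); `hull` is invariant under smooth `k`-morphisms and perfect ground-field extensions at singular
points (ATW functoriality of the maximal admissible centre for smooth morphisms; AQS Thm 3.5 stability
under separable — here: all — extensions of a perfect field; singular generisations correspond under
smooth maps by going-down for flat morphisms). -/
theorem stub_hullUsc : ∀ p : ℕ, p.Prime → ∀ R : LexmaxHullRule p,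
    R.USC ∧ R.HullComap ∧ R.HullBaseChange := by
  sorry

/-- **Stub C (`(iii)`).** For every rule (under the guard "some singular point"): the centre is a
REGULAR WEIGHTED CENTRE — i.e. the maximum locus of the hull is a regular closed subscheme of `Y` along
which the support-constrained lexmax chart at its generic point extends as part of a regular system of
parameters (the analogue of "the maximum locus of `inv` is smooth", ATW Thm 1.1.1; the bet: a singular
point of the closure of a stratum is isolated by its own profile, e.g. node of a nodal curve of cusps:
(2,6,6) > (2,3)) — and the centre is functorial for smooth surjective `k`-morphisms and perfect base
change (canonicity of "lex-maximal among max-locus-supported admissible centres"). -/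
theorem stub_centreRegular : ∀ p : ℕ, p.Prime → ∀ R : LexmaxHullRule p, R.CentreRegular := by
  sorry

/-- **Stub D (`(iv)`, THE CORE — research, falsifiable by one specimen).** For every rule, the
positional drop of the hull on the cobordant blow-up of its own centre, in the landed ACChart form
(over `k̄`, weighted chart opens, closed singular exceptional points). Calibrated by hand on the six
standing specimens of the crux (line card §Calibration): umbrella, `z⁸+x²y⁸(1+y)`, `x²+y²(1+y)z²+z⁵`,
the fuel witness `z²+y³+ty⁴+t⁶y` ((2,3,9) → (2,3,3,12)), `f_k = z²+x³y+x²y^{2k+1}` ((2,4,4) → (2,3,6k−3)),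
Hauser–Perlega Example 1 ((8,16,16,16) → (8,10,10), (8,11,11,11), (8,12,12)); in transversal dimension 2
it is AQS arXiv:2507.01232 Thm 1.1(3)/1.3(3) (order drops); weighted-homogeneous isolated germs: the
landed one-step principle. First open rung: transversal dimension 3 at wild orders (8899 CORE W). -/
theorem stub_hullDrop : ∀ p : ℕ, p.Prime → ∀ R : LexmaxHullRule p, R.HullDrop := by
  sorry

/-- **Stub E (S2 recoding + packaging).** A rule with `(usc)`, `(i)`, `(iii)` and the drop `(iv)` IN THE
PROFILE ORDER yields an algebraically-closed chart pre-datum (hence, by the landed reductions, a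
`WeightedResolutionDatum p`): `inv := ⊥` at regular-or-absent points (axiom `(ii)` by construction, as
in c1's `SupportFirstPreDatum.toDatum`), and on singular points a WELL-ORDERED recoding of the realised
hull values compatible with every comparison the axioms make (usc within a pair, the maximum locus, the
drop). The `∞`-padded lex order on all profiles is NOT well-founded (`(2,⊤) > (2,2,⊤) > (2,2,2,⊤) > …`,
cdisprove Part I §2 `not_wellFounded_atwLT`, lead a2 §4); the content is BOUNDED LENGTHENING along the
rule's forced chains (specialisations inside a pair; successors on `B₊`): components of the top locus on
an iterated cobordant blow-up `B₊^{(m)}` are `𝔾ₘ^m`-stable, orbits are `m`-dimensional (finite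
stabilisers, AQS Thm 1.1(2) / Włodarczyk 2.3.9), so the rated generic points have local rings of
dimension `≤ dim Y` and realised profiles along a tower have bounded length; then rank the forced
relation by ordinals. -/
theorem stub_recoding : ∀ p : ℕ, p.Prime → ∀ R : LexmaxHullRule p,
    (R.USC ∧ R.HullComap ∧ R.HullBaseChange) → R.CentreRegular → R.HullDrop →
    Nonempty (ACChartPreDatum p) := by
  sorry

/-! ## Composition (sorry-free): the five stubs conclude the crux BY NAME -/

/-- **The line concludes the crux.** From the five stubs: for each prime `p` take the rule (A), its
`(usc)`/`(i)` (B), its regular functorial centre (C) and its drop (D), recode into an algebraically-closed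
chart pre-datum (E), and apply the landed equivalence `weightedConstruction_iff_acChartPreDatum`
(Theorems/…ACEquivalence.lean, p136232: `ACChartPreDatum → PreDatum → WeightedResolutionDatum`). -/
theorem WeightedConstruction_of
    (hA : ∀ p : ℕ, p.Prime → Nonempty (LexmaxHullRule p))
    (hB : ∀ p : ℕ, p.Prime → ∀ R : LexmaxHullRule p, R.USC ∧ R.HullComap ∧ R.HullBaseChange)
    (hC : ∀ p : ℕ, p.Prime → ∀ R : LexmaxHullRule p, R.CentreRegular)
    (hD : ∀ p : ℕ, p.Prime → ∀ R : LexmaxHullRule p, R.HullDrop)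
    (hE : ∀ p : ℕ, p.Prime → ∀ R : LexmaxHullRule p,
      (R.USC ∧ R.HullComap ∧ R.HullBaseChange) → R.CentreRegular → R.HullDrop →
      Nonempty (ACChartPreDatum p)) :
    WeightedConstruction :=
  weightedConstruction_iff_acChartPreDatum.mpr fun p hp => by
    obtain ⟨R⟩ := hA p hp
    exact hE p hp R (hB p hp R) (hC p hp R) (hD p hp R)

/-- The crux from the registered stubs, literally. -/
theorem weightedConstruction : WeightedConstruction :=
  WeightedConstruction_of stub_ruleExists stub_hullUsc stub_centreRegular stub_hullDrop stub_recoding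

end Summit.ResolutionOfSingularities.ResolutionOfSingularities.Cruxes.WeightedConstruction.PointwiseLexmaxHull

end
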